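import Summits.ABC.ABC.Theses.IsogenyGlueCongruence
import Summits.ABC.ABC.Theorems.IsogenyGlueCongruenceEllipticGluingPrimeBoundStubRationalPartReductionAux
import Summits.ABC.ABC.Theorems.IsogenyGlueCongruenceEllipticGluingPrimeBoundStubGeomIsotypicProjector
import Summits.ABC.ABC.Theorems.IsogenyGlueCongruenceEllipticGluingPrimeBoundFreeOfBound
import Literature.AlgebraicGeometry.Motives.AbelianVarietyQuotientGeomPoints
import Literature.NumberTheory.DiophantineGeometry.AVIsogenyTateRationalEquivProofs
import Literature.NumberTheory.DiophantineGeometry.AVIsogenyTateHomPoincareProofs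
import Literature.NumberTheory.DiophantineGeometry.AVGaloisModuleContinuityProofs
import HarnessLib

/-!
# Crux `EllipticGluingPrimeBound`, line Sketch — stub `stub_quotientByAbelianSubvariety`
# (the quotient `A/A₁` by an abelian subvariety over `ℚ`, on geometric points)

Stub `stub_quotientByAbelianSubvariety` (NEW in skeleton v11) of line `Sketch` (isotypic–Minkowski
reduction) of crux U `Summit.ABC.ABC.Theses.IsogenyGlueCongruence.EllipticGluingPrimeBound`
(stmt-ABC-13919).  Skeleton v11 sharpens the residual open statement `U_free` to ℚ-SIMPLE partners
by induction on `dim A`; the induction step (`stub_freeOfSimple`) needs the quotient `A/A₁` of an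
abelian variety `A/ℚ` by an abelian subvariety `i : A₁ ↪ A`, and uses it only ON GEOMETRIC POINTS.

**Statement.** For a closed-immersion homomorphism `i : A₁ ↪ A` of abelian varieties over `ℚ` there
are `Z'/ℚ` with `dim Z' + dim A₁ = dim A` and a `Γ_ℚ`-equivariant additive map
`Φ : A(ℚ̄) →+ Z'(ℚ̄)` with `ker Φ = i(A₁(ℚ̄))`, along which geometric freeness transfers: every
`X/ℚ̄` with `Hom(X, A_ℚ̄) = 0` has `Hom(X, Z'_ℚ̄) = 0`.

**Proof.**
1. Poincaré reducibility over `ℚ` (the landed `exists_rational_quasiRetraction` and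
   `exists_isIsogeny_desc_of_quasiRetraction`, file `…StubRationalPartReductionAux`): a complement
   `j : Z → A` with `σ = (i, j) : A₁ ⊞ Z → A` an isogeny; a quasi-inverse `τ`, `σ ≫ τ = [m]`
   (`IsIsogeny.exists_nsmul_inverse_holds`).
2. `K = j⁻¹(i(A₁(ℚ̄))) ≤ Z(ℚ̄)` is `Γ_ℚ`-stable (equivariance of `i`, `j`), killed by `m` (if
   `j z = i a` then `σ(inr z - inl a) = 0`, so `m • (inr z - inl a) = τ σ (…) = 0`, and its second
   coordinate is `m • z`), hence finite (`Z[m]` is finite, `finite_geomTorsion_of_cast_ne_zero`);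
   the tree's quotient theorem `AbelianVariety.exists_isogeny_geomKer_eq_of_isIsogeny` (Mumford §7
   Thm. 4, Kieffer Prop. 1.1.10) gives an isogeny `h : Z → Z' = Z/K` over `ℚ` with `ker h(ℚ̄) = K`.
3. `Φ` is the factorisation through the surjection `σ : (A₁ ⊞ Z)(ℚ̄) ↠ A(ℚ̄)`
   (`IsIsogeny.geomPointsMap_surjective`, Mathlib `AddMonoidHom.liftOfSurjective`) of
   `ψ = h ∘ snd`: `ker σ ≤ ker ψ` because `σ x = i(fst x) + j(snd x) = 0` puts `snd x` in `K`.
   So `Φ(i a + j z) = h z`; equivariance and `ker Φ = i(A₁(ℚ̄))` are then one-line computations.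
4. `dim Z' = dim Z = dim A - dim A₁` (`dim_eq_of_isIsogeny`, `dim_biprod`).
5. Freeness transfers along any `u : Z → A` with `u ≫ v = [m]`, `m ≥ 1`
   (`hom_baseChange_eq_zero_of_quasiSplit`: `f ≫ u_ℚ̄ = 0 ⟹ [m] ≫ f = 0 ⟹ f = 0`, cancelling the
   isogeny `[m]_X`); apply it to `j` (`j ≫ τ ≫ snd = [m]`) and to a quasi-inverse `g` of `h`
   (`g ≫ h = [n]`).

Everything is proved (axioms `propext`, `Classical.choice`, `Quot.sound`); no `def`, no named fact.
Helpers live in the sub-namespace `QuotientByAbelianSubvariety`.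

References: D. Mumford, *Abelian Varieties* (1970), §7 Thm. 4 (p. 72), §19 Thm. 1 and Remark
p. 169; J. Kieffer, *Isogeny graphs of abelian varieties*, Prop. 1.1.10.
-/

noncomputable section

-- `Summit.<Summit>.<Problem>` is the mandated summit-side namespace (CONVENTIONS §2); for the
-- single-conjunct summit `ABC` the two coincide, so the duplicate `ABC.ABC` is deliberate.
set_option linter.dupNamespace false

namespace Summit.ABC.ABC.Theorems.IsotypicMinkowski

open CategoryTheory CategoryTheory.Limits AlgebraicGeometry
open Literature.AlgebraicGeometry.Motives
open Summit.ABC.ABC.Theses.IsogenyGlueCongruence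

namespace QuotientByAbelianSubvariety

open Literature.AlgebraicGeometry.Motives.AbelianVariety

/-! ### Points of `n • f`, `f ≫ g`, `[n]` -/

/-- `(n • f)(x) = n • f(x)` on geometric points (`geomPointsMap` is additive in `f`). -/
theorem geomPointsMap_zsmul_apply {X Y : AbelianVariety.{0} ℚ} (f : X ⟶ Y) (n : ℤ)
    (x : X.geomPoints) : Hom.geomPointsMap (n • f) x = n • Hom.geomPointsMap f x := by
  rw [← Hom.geomPointsMapAddMonoidHom_apply, map_zsmul, Hom.geomPointsMapAddMonoidHom_apply,
    AddMonoidHom.smul_apply]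

/-- `(f ≫ g)(x) = g(f(x))` on geometric points (functoriality of `geomPointsMap`). -/
theorem geomPointsMap_comp_apply {X Y W : AbelianVariety.{0} ℚ} (f : X ⟶ Y) (g : Y ⟶ W)
    (x : X.geomPoints) :
    Hom.geomPointsMap (f ≫ g) x = Hom.geomPointsMap g (Hom.geomPointsMap f x) := by
  rw [Hom.geomPointsMap_comp, AddMonoidHom.comp_apply]

/-- `[n](x) = n • x` on geometric points, for `n : ℕ`. -/
theorem geomPointsMap_nsmul_id_apply (X : AbelianVariety.{0} ℚ) (n : ℕ) (x : X.geomPoints) :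
    Hom.geomPointsMap (n • 𝟙 X) x = (n : ℤ) • x := by
  rw [show (n • 𝟙 X : X ⟶ X) = (n : ℤ) • 𝟙 X from (natCast_zsmul _ _).symm,
    geomPointsMap_zsmul_apply, Hom.geomPointsMap_id, AddMonoidHom.id_apply]

/-! ### Freeness transfer along a quasi-split homomorphism -/

/-- **Geometric freeness transfers along a quasi-split homomorphism**: if `u : Z → A` has
`u ≫ v = m • 𝟙 Z` with `0 < m`, then every `X/ℚ̄` with `Hom(X, A_ℚ̄) = 0` has `Hom(X, Z_ℚ̄) = 0`.
For `f : X → Z_ℚ̄`: `f ≫ u_ℚ̄ = 0`, so `f ≫ [m] = [m]_X ≫ f = 0`, and the isogeny `[m]_X` cancels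
(`isIsogeny_zsmul_id_of_cast_ne_zero`, `IsIsogeny.cancel_left`). -/
theorem hom_baseChange_eq_zero_of_quasiSplit {Z A : AbelianVariety.{0} ℚ} (u : Z ⟶ A) (v : A ⟶ Z)
    {m : ℕ} (hm : 0 < m) (huv : u ≫ v = m • 𝟙 Z) (X : AbelianVariety.{0} (AlgebraicClosure ℚ))
    (hA : ∀ f : X ⟶ A.baseChange (AlgebraicClosure ℚ), f = 0)
    (f : X ⟶ Z.baseChange (AlgebraicClosure ℚ)) : f = 0 := by
  have h1 : f ≫ Hom.baseChange (AlgebraicClosure ℚ) u = 0 := hA _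
  have h2 : f ≫ Hom.baseChange (AlgebraicClosure ℚ) (u ≫ v) = 0 := by
    rw [Hom.baseChange_comp, ← Category.assoc, h1, zero_comp]
  rw [huv, show (m • 𝟙 Z : Z ⟶ Z) = (m : ℤ) • 𝟙 Z from (natCast_zsmul _ _).symm,
    baseChange_zsmul_id, Preadditive.comp_zsmul, Category.comp_id, ← Category.id_comp f,
    ← Preadditive.zsmul_comp] at h2
  have hm' : ((m : ℤ) : AlgebraicClosure ℚ) ≠ 0 := by
    have : (m : AlgebraicClosure ℚ) ≠ 0 := by exact_mod_cast hm.ne'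
    exact_mod_cast this
  exact (isIsogeny_zsmul_id_of_cast_ne_zero (A := X) (m : ℤ) hm').cancel_left
    (h2.trans comp_zero.symm)

/-! ### The quotient map on points for an isogeny splitting `(i, j) : A₁ ⊞ Z → A` -/

/-- **The quotient `A → Z/K` on geometric points.** Let `(i, j) : A₁ ⊞ Z → A` be an isogeny over
`ℚ`. With `K = j⁻¹(i(A₁(ℚ̄))) ≤ Z(ℚ̄)` — `Γ_ℚ`-stable, killed by `m` where `(i, j) ≫ τ = [m]`, hence
finite — and `h : Z → Z' = Z/K` the quotient isogeny (`exists_isogeny_geomKer_eq_of_isIsogeny`),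
the map `ψ = h ∘ snd : (A₁ ⊞ Z)(ℚ̄) → Z'(ℚ̄)` kills `ker (i, j)` and factors through the surjection
`(i, j) : (A₁ ⊞ Z)(ℚ̄) ↠ A(ℚ̄)` as a `Γ_ℚ`-equivariant `Φ : A(ℚ̄) →+ Z'(ℚ̄)`, `Φ(i a + j z) = h z`,
with `ker Φ = i(A₁(ℚ̄))`. -/
theorem exists_quotient_of_isIsogeny_desc {A A₁ Z : AbelianVariety.{0} ℚ} (i : A₁ ⟶ A)
    (j : Z ⟶ A) (hσ : IsIsogeny (biprod.desc i j)) :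
    ∃ (Z' : AbelianVariety.{0} ℚ) (h : Z ⟶ Z') (Φ : A.geomPoints →+ Z'.geomPoints),
      IsIsogeny h ∧
      (∀ (σ : Field.absoluteGaloisGroup ℚ) (P : A.geomPoints), Φ (σ • P) = σ • Φ P) ∧
      (∀ P : A.geomPoints, Φ P = 0 ↔ P ∈ (Hom.geomPointsMap i).range) := by
  classical
  obtain ⟨τ, m, hm, hστ, -⟩ := IsIsogeny.exists_nsmul_inverse_holds hσ
  -- biproduct identities on points
  have hσ_inl : ∀ a : A₁.geomPoints, Hom.geomPointsMap (biprod.desc i j)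
      (Hom.geomPointsMap (biprod.inl : A₁ ⟶ A₁ ⊞ Z) a) = Hom.geomPointsMap i a := fun a ↦ by
    rw [← geomPointsMap_comp_apply, biprod.inl_desc]
  have hσ_inr : ∀ z : Z.geomPoints, Hom.geomPointsMap (biprod.desc i j)
      (Hom.geomPointsMap (biprod.inr : Z ⟶ A₁ ⊞ Z) z) = Hom.geomPointsMap j z := fun z ↦ by
    rw [← geomPointsMap_comp_apply, biprod.inr_desc]
  have hsnd_inl : ∀ a : A₁.geomPoints, Hom.geomPointsMap (biprod.snd : A₁ ⊞ Z ⟶ Z)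
      (Hom.geomPointsMap (biprod.inl : A₁ ⟶ A₁ ⊞ Z) a) = 0 := fun a ↦ by
    rw [← geomPointsMap_comp_apply, biprod.inl_snd, Hom.geomPointsMap_zero,
      AddMonoidHom.zero_apply]
  have hsnd_inr : ∀ z : Z.geomPoints, Hom.geomPointsMap (biprod.snd : A₁ ⊞ Z ⟶ Z)
      (Hom.geomPointsMap (biprod.inr : Z ⟶ A₁ ⊞ Z) z) = z := fun z ↦ by
    rw [← geomPointsMap_comp_apply, biprod.inr_snd, Hom.geomPointsMap_id, AddMonoidHom.id_apply]
  have hσ_apply : ∀ x : (A₁ ⊞ Z).geomPoints, Hom.geomPointsMap (biprod.desc i j) x =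
      Hom.geomPointsMap i (Hom.geomPointsMap (biprod.fst : A₁ ⊞ Z ⟶ A₁) x) +
        Hom.geomPointsMap j (Hom.geomPointsMap (biprod.snd : A₁ ⊞ Z ⟶ Z) x) := fun x ↦ by
    conv_lhs => rw [biprod.desc_eq]
    rw [Hom.geomPointsMap_add, AddMonoidHom.add_apply, geomPointsMap_comp_apply,
      geomPointsMap_comp_apply]
  have hτσ_apply : ∀ x : (A₁ ⊞ Z).geomPoints,
      Hom.geomPointsMap τ (Hom.geomPointsMap (biprod.desc i j) x) = (m : ℤ) • x := fun x ↦ by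
    rw [← geomPointsMap_comp_apply, hστ, geomPointsMap_nsmul_id_apply]
  -- the subgroup `K = j⁻¹(i(A₁(ℚ̄)))` of `Z(ℚ̄)`
  let K : AddSubgroup Z.geomPoints := (Hom.geomPointsMap i).range.comap (Hom.geomPointsMap j)
  have hK : ∀ z : Z.geomPoints,
      z ∈ K ↔ ∃ a : A₁.geomPoints, Hom.geomPointsMap i a = Hom.geomPointsMap j z := fun z ↦ by
    simp only [K, AddSubgroup.mem_comap, AddMonoidHom.mem_range]
  -- `K` is killed by `m`
  have hKm : ∀ z ∈ K, (m : ℤ) • z = 0 := by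
    intro z hz
    obtain ⟨a, ha⟩ := (hK z).1 hz
    have h0 : Hom.geomPointsMap (biprod.desc i j)
        (Hom.geomPointsMap (biprod.inr : Z ⟶ A₁ ⊞ Z) z -
          Hom.geomPointsMap (biprod.inl : A₁ ⟶ A₁ ⊞ Z) a) = 0 := by
      rw [map_sub, hσ_inr, hσ_inl, ha, sub_self]
    have h1 : (m : ℤ) • (Hom.geomPointsMap (biprod.inr : Z ⟶ A₁ ⊞ Z) z -
        Hom.geomPointsMap (biprod.inl : A₁ ⟶ A₁ ⊞ Z) a) = 0 := by
      rw [← hτσ_apply, h0, map_zero]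
    have h2 := congrArg (Hom.geomPointsMap (biprod.snd : A₁ ⊞ Z ⟶ Z)) h1
    rwa [map_zsmul, map_sub, hsnd_inr, hsnd_inl, sub_zero, map_zero] at h2
  -- `K` is finite (inside `Z[m]`)
  have hm0 : ((m : ℤ) : ℚ) ≠ 0 := by exact_mod_cast hm.ne'
  have hKfin : (K : Set Z.geomPoints).Finite := by
    haveI : Finite (Z.geomTorsion (m : ℤ)) := Z.finite_geomTorsion_of_cast_ne_zero (m : ℤ) hm0
    refine Set.Finite.subset (Set.toFinite (Z.geomTorsion (m : ℤ) : Set Z.geomPoints)) ?_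
    intro z hz
    exact (AbelianVariety.mem_geomTorsion_iff' z).2 (hKm z hz)
  -- `K` is `Γ_ℚ`-stable
  have hKstab : ∀ (σ : Field.absoluteGaloisGroup ℚ) (z : Z.geomPoints), z ∈ K → σ • z ∈ K := by
    intro σ z hz
    obtain ⟨a, ha⟩ := (hK z).1 hz
    exact (hK _).2 ⟨σ • a, by rw [Hom.geomPointsMap_smul, Hom.geomPointsMap_smul, ha]⟩
  -- `K` is killed by the isogeny `[m]_Z`
  have hq : IsIsogeny ((m : ℤ) • 𝟙 Z) := isIsogeny_zsmul_id_of_cast_ne_zero (A := Z) (m : ℤ) hm0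
  have hKq : ∀ z ∈ K, Hom.geomPointsMap ((m : ℤ) • 𝟙 Z) z = 0 := by
    intro z hz
    rw [geomPointsMap_zsmul_apply, Hom.geomPointsMap_id, AddMonoidHom.id_apply]
    exact hKm z hz
  -- the quotient `Z' = Z/K`
  obtain ⟨Z', h, hh, hker, -⟩ := exists_isogeny_geomKer_eq_of_isIsogeny Z K hKfin hKstab _ hq hKq
  -- the factorisation `Φ` of `ψ = h ∘ snd` through the surjection `σ`
  have hsurj : Function.Surjective (Hom.geomPointsMap (biprod.desc i j)) :=
    IsIsogeny.geomPointsMap_surjective hσ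
  let ψ : (A₁ ⊞ Z).geomPoints →+ Z'.geomPoints :=
    (Hom.geomPointsMap h).comp (Hom.geomPointsMap (biprod.snd : A₁ ⊞ Z ⟶ Z))
  have hψ : ∀ x, ψ x = Hom.geomPointsMap h (Hom.geomPointsMap (biprod.snd : A₁ ⊞ Z ⟶ Z) x) :=
    fun x ↦ rfl
  have hle : (Hom.geomPointsMap (biprod.desc i j)).ker ≤ ψ.ker := by
    intro x hx
    rw [AddMonoidHom.mem_ker] at hx ⊢
    rw [hψ, hker, hK]
    refine ⟨-Hom.geomPointsMap (biprod.fst : A₁ ⊞ Z ⟶ A₁) x, ?_⟩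
    rw [map_neg]
    apply neg_eq_of_add_eq_zero_right
    rw [← hσ_apply]
    exact hx
  let Φ : A.geomPoints →+ Z'.geomPoints :=
    (Hom.geomPointsMap (biprod.desc i j)).liftOfSurjective hsurj ⟨ψ, hle⟩
  have hΦ : ∀ x, Φ (Hom.geomPointsMap (biprod.desc i j) x) = ψ x := fun x ↦
    AddMonoidHom.liftOfRightInverse_comp_apply _ _ _ ⟨ψ, hle⟩ x
  refine ⟨Z', h, Φ, hh, ?_, ?_⟩
  · -- equivariance
    intro σ P
    obtain ⟨x, rfl⟩ := hsurj P
    rw [← Hom.geomPointsMap_smul, hΦ, hΦ, hψ, hψ, Hom.geomPointsMap_smul, Hom.geomPointsMap_smul]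
  · -- kernel
    intro P
    obtain ⟨x, rfl⟩ := hsurj P
    rw [hΦ, hψ, hker, hK, AddMonoidHom.mem_range]
    constructor
    · rintro ⟨a, ha⟩
      exact ⟨Hom.geomPointsMap (biprod.fst : A₁ ⊞ Z ⟶ A₁) x + a, by rw [map_add, ha, ← hσ_apply]⟩
    · rintro ⟨a, ha⟩
      exact ⟨a - Hom.geomPointsMap (biprod.fst : A₁ ⊞ Z ⟶ A₁) x, by
        rw [map_sub, ha, hσ_apply, add_sub_cancel_left]⟩

end QuotientByAbelianSubvariety

/-! ### The stub -/

/-- **Stub `stub_quotientByAbelianSubvariety` of line Sketch (skeleton v11): the quotient by an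
abelian subvariety over `ℚ`, on geometric points.** For a closed-immersion homomorphism
`i : A₁ ↪ A` of abelian varieties over `ℚ` there are `Z'/ℚ` with `dim Z' + dim A₁ = dim A` and a
`Γ_ℚ`-equivariant additive map `Φ : A(ℚ̄) →+ Z'(ℚ̄)` whose kernel is exactly `i(A₁(ℚ̄))`, such that
every `X/ℚ̄` with `Hom(X, A_ℚ̄) = 0` has `Hom(X, Z'_ℚ̄) = 0`.  Poincaré over `ℚ`
(`exists_rational_quasiRetraction`, `exists_isIsogeny_desc_of_quasiRetraction`) gives an isogeny
`(i, j) : A₁ ⊞ Z → A`; `Z' = Z/K`, `K = j⁻¹(i A₁)` finite, and `Φ(i a + j z) = [z]`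
(`QuotientByAbelianSubvariety.exists_quotient_of_isIsogeny_desc`);
`dim Z' = dim Z = dim A - dim A₁`; freeness transfers along `j` (`j ≫ τ ≫ snd = [m]`) and along a
quasi-inverse of `Z → Z'` (`QuotientByAbelianSubvariety.hom_baseChange_eq_zero_of_quasiSplit`). -/
theorem stub_quotientByAbelianSubvariety :
    ∀ (A A₁ : AbelianVariety.{0} ℚ) (i : A₁ ⟶ A),
      IsClosedImmersion (AbelianVariety.Hom.toSchemeHom i) →
      ∃ (Z' : AbelianVariety.{0} ℚ) (Φ : A.geomPoints →+ Z'.geomPoints),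
        Z'.dim + A₁.dim = A.dim ∧
        (∀ (σ : Field.absoluteGaloisGroup ℚ) (P : A.geomPoints), Φ (σ • P) = σ • Φ P) ∧
        (∀ P : A.geomPoints, Φ P = 0 ↔ P ∈ (AbelianVariety.Hom.geomPointsMap i).range) ∧
        ∀ X : AbelianVariety.{0} (AlgebraicClosure ℚ),
          (∀ f : X ⟶ A.baseChange (AlgebraicClosure ℚ), f = 0) →
          ∀ f : X ⟶ Z'.baseChange (AlgebraicClosure ℚ), f = 0 := by
  intro A A₁ i hi
  haveI := hi
  -- Poincaré reducibility over `ℚ`: `(i, j) : A₁ ⊞ Z → A` an isogeny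
  obtain ⟨q, M, hM, hiq⟩ := exists_rational_quasiRetraction i
  obtain ⟨Z, j, hσ⟩ := exists_isIsogeny_desc_of_quasiRetraction i q hM hiq
  -- the quotient `Z' = Z/K` and `Φ`
  obtain ⟨Z', h, Φ, hh, hequiv, hkerΦ⟩ :=
    QuotientByAbelianSubvariety.exists_quotient_of_isIsogeny_desc i j hσ
  refine ⟨Z', Φ, ?_, hequiv, hkerΦ, ?_⟩
  · -- dimensions
    have h1 : (A₁ ⊞ Z).dim = A.dim := AbelianVariety.dim_eq_of_isIsogeny hσ
    have h2 : Z.dim = Z'.dim := AbelianVariety.dim_eq_of_isIsogeny hh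
    rw [AbelianVariety.dim_biprod] at h1
    omega
  · -- freeness transfer `A ⇝ Z ⇝ Z'`
    intro X hX
    obtain ⟨τ, m, hm, hστ, -⟩ := AbelianVariety.IsIsogeny.exists_nsmul_inverse_holds hσ
    have hj : j ≫ (τ ≫ biprod.snd) = m • 𝟙 Z := by
      calc j ≫ (τ ≫ biprod.snd) = (biprod.inr ≫ biprod.desc i j) ≫ (τ ≫ biprod.snd) := by
            rw [biprod.inr_desc]
        _ = m • 𝟙 Z := by
            rw [Category.assoc, reassoc_of% hστ, Preadditive.nsmul_comp, Category.id_comp,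
              Preadditive.comp_nsmul, biprod.inr_snd]
    have hZ : ∀ f : X ⟶ Z.baseChange (AlgebraicClosure ℚ), f = 0 :=
      QuotientByAbelianSubvariety.hom_baseChange_eq_zero_of_quasiSplit j (τ ≫ biprod.snd) hm hj X hX
    obtain ⟨g, n, hn, -, hgh⟩ := AbelianVariety.IsIsogeny.exists_nsmul_inverse_holds hh
    exact QuotientByAbelianSubvariety.hom_baseChange_eq_zero_of_quasiSplit g h hn hgh X hZ

end Summit.ABC.ABC.Theorems.IsotypicMinkowski

end
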